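import Literature.Geometry.Kaehler.ComplexTorusIntegralLefschetzFormDegreeTwoSignature
import Literature.Geometry.Kaehler.ComplexTorusIntegralLefschetzFormEven
import Literature.Topology.FourManifolds.LatticeFormsTwoElementaryDiscriminantForm
import Literature.Topology.FourManifolds.LatticeFormsTwoElementaryInvariants
import Literature.Topology.FourManifolds.LatticeFormsEvenIndefiniteIsotropic
import HarnessLib

/-!
# The Lefschetz lattice of a principally polarised abelian threefold:
# `(H²(X, ℤ), (x, y) ↦ ∫_X x ∧ θ ∧ y) ≅ U^{⊕7} ⊕ ⟨−2⟩` after the Kähler sign (Nikulin's `2`-elementary normal form)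

Layer `Literature/Geometry/Kaehler`, namespace `Literature.Geometry.Kaehler.ComplexTorus`; lane `lit-hodgefound`
(Track 2 foundations library), seat p09, generation 44, row g44-#2. THEOREMS ONLY (0 definitions); no named fact,
net debt 0. The capstone of the p09 lattice series g41-#1 (`|disc B₂| = g − 1` for constant type), g41-#4 (`B₂` is
even), g43-#3 (`(b⁺, b⁻)(s·B₂) = (2·C(g,2) + 1, g² − 1)`): for `g = 3` these invariants are `rank 15`, `|disc| = 2`,
even, `σ = −1` — an even indefinite `2`-ELEMENTARY lattice with Nikulin invariants `(r, a, δ) = (15, 1, 1)`, hence (Nikulin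
1980 Thm. 3.6.2 with Cor. 1.13.3, in the tree as p18's `IsTwoElementary.exists_isometry_of_invariants_eq` and
`equivalent_of_discriminantQuad_iso_of_isIndefinite_of_length_add_three_le`) ISOMETRIC to the standard lattice with the
same invariants, `U^{⊕7} ⊕ A₁` (Alexeev–Nikulin §9.4.1: `U ⊕ E₈ ⊕ A₁` has `(11, 1, 1)`; here `E₈^{⊕0} ⊕ U^{⊕7} ⊕ A₁`).

## Dictionary

`X = E/Φ(ℤ^ι)` a complex torus of dimension `3` with a Riemann form `η` of CONSTANT type `(d, d, d)` (`IsPolarizationType Φ η d`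
with `d i = d 0`; e.g. a principal polarisation, `d = (1, 1, 1)`), ANY presentation, any orientation `e : Fin n ≃ ι` (`n = 6`),
`sign = orientationSign Φ e`, `s = sign·(−1)^1 = −sign` (the Kähler normalisation of degree two, `s = sign·(−1)^g·(−1)^{…}` as in
g43-#3: `s·B₂` is the lattice form whose real extension is a POSITIVE multiple of Voisin's `Q₂(α, β) = ∫ ω ∧ α ∧ β`),
`γ = θ_ℂ/d` the integral minimal class of degree two (`1!·d·γ = θ_ℂ`), `B₂(x, y) = ⟨x, γ ∧ y⟩_e` on `H²(X, ℤ) = integralForms Φ 2`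
(hypothesis `hB`; for a principal polarisation `B₂(x, y) = ⟨x, θ ∧ y⟩_e = x·y·Θ`). The model:
`U^{⊕m} = LinearMap.BilinForm.hyperbolicSum m` on `ℤ^m × ℤ^m`, `A₁ = ⟨−2⟩ = (2 : ℤ) • pi (fun _ : Fin 1 ↦ (−1) • mul)` on
`ℤ^1` (p18's `lA₁` with `l = 1`), `U^{⊕7} ⊕ A₁ = (hyperbolicSum 7).prod A₁`.

## What is proved

* §0 `invariants_hyperbolicSum_prod_A1`: **`U^{⊕m} ⊕ A₁` is even, symmetric, non-degenerate, `2`-elementary with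
  `(r, a, δ) = (2m + 1, 1, 1)` and `σ = −1`**, indefinite for `m ≥ 1` (Alexeev–Nikulin §9.4.1's `E₈^{⊕k} ⊕ U^{⊕n} ⊕ A₁`
  row with `k = 0`).
* §1 `IsPolarizationType.invariants_smul_of_eq_poincarePairing_wedge_threefold`: for a threefold of constant type,
  **`(H²(X, ℤ), s·B₂)` is even, symmetric, non-degenerate of rank `15`, signature `−1`, with discriminant group of order
  `2` — hence `2`-elementary with `(r, a, δ) = (15, 1, 1)`**.
* §2 the headline `IsPolarizationType.smul_equivalent_hyperbolicSum_prod_A1_threefold`: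
  **`(H²(X, ℤ), s·B₂) ≅ U^{⊕7} ⊕ A₁`**; the unsigned forms (`sign = −1`: `B₂ ≅ U^{⊕7} ⊕ A₁`; complex orientation
  `sign = 1`: `−B₂ ≅ U^{⊕7} ⊕ A₁`, i.e. `B₂ ≅ U^{⊕7} ⊕ ⟨2⟩`), the principal-polarisation form
  (`B₂(x, y) = ⟨x, θ ∧ y⟩ = x·y·Θ`), the existence form, and **uniqueness**: the Lefschetz lattices of degree two of ANY
  two principally polarised (or constant-type) abelian threefolds are isometric.

## The sources, verbatim

* V. V. Nikulin, *Integral symmetric bilinear forms and some of their geometric applications*, Math. USSR Izv. 14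
  (1980), Thm. 3.6.2: an even `2`-elementary lattice with invariants `(r, a, δ)` (indefinite, `r ≥ 3`/in the genus
  range) is unique up to isometry and determined by `(t₍₊₎, t₍₋₎, a, δ)`; Cor. 1.13.3: an even indefinite lattice with
  `rk ≥ ℓ(A) + 2` is determined by its signature and discriminant form (in the tree with `+ 3`, p18).
* V. Alexeev, V. V. Nikulin, *Del Pezzo and K3 surfaces*, MSJ Memoirs 15 (2006), §9.2 (p0052): "the discriminant form
  `q_M` is determined by its invariants (`σ ≡ t₍₊₎ − t₍₋₎ mod 8`, `a`, `δ`)"; §9.4.1: "`S = U ⊕ E₈ ⊕ A₁` … `(r, a, δ) =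
  (11, 1, 1)`".
* D. Huybrechts, *Lectures on K3 Surfaces* (CUP 2016), Ch. 14 Thm. 1.5 / Rem. 1.6 (uniqueness in the genus for
  `ℓ(A_Λ) + 2 ≤ rk Λ`), Cor. 3.3.16 of *Complex Geometry* (index `(2h^{2,0} + 1, h^{1,1} − 1)` = `(7, 8)` for an abelian
  threefold).
* H. Lange, *Abelian Varieties over the Complex Numbers* (2023), §6.2.4 (PDF p. 310) (the pairing `⟨x, θ ∧ y⟩`), §1.7.2
  Lemma 1.7.5, §2.1.1.

## References

* [Nikulin1980] V. V. Nikulin, Integral symmetric bilinear forms and some of their applications, Math. USSR Izv. 14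
  (1980) 103–167, Thm. 3.6.2, Cor. 1.13.3.
* [AlexeevNikulin2006] V. Alexeev, V. V. Nikulin, Del Pezzo and K3 surfaces, MSJ Memoirs 15 (2006), §9.2, §9.4.1.
* [Huybrechts2016K3] D. Huybrechts, Lectures on K3 Surfaces, CUP 2016, Ch. 14 §0.1, Thm. 1.5, Rem. 1.6.
* [Huybrechts2005] D. Huybrechts, Complex Geometry. An Introduction, Springer 2005, Cor. 3.3.16.
* [Lange2023AbelianVarietiesComplex] H. Lange, Abelian Varieties over the Complex Numbers, Springer 2023, §6.2.4,
  §1.7.2, §2.1.1, §1.1.3.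
* [Serre1973] J.-P. Serre, A Course in Arithmetic, GTM 7, Springer 1973, Ch. V §1.3.
-/

noncomputable section

open Module Function
open LinearMap (BilinForm)
open Literature.LinearAlgebra.Alternating

namespace Literature.Geometry.Kaehler.ComplexTorus

/-! ## §0 The model `U^{⊕m} ⊕ A₁`: invariants `(2m + 1, 1, 1)`, `σ = −1` -/

section Model

/-- **`U^{⊕m} ⊕ A₁` is an even symmetric non-degenerate `2`-elementary lattice with `(r, a, δ) = (2m + 1, 1, 1)` and
`σ = −1`** (`A₁ = ⟨−2⟩`; Alexeev–Nikulin's row "`E₈^{⊕k} ⊕ U^{⊕n} ⊕ A₁`: `(8k + 2n + 1, 1, 1)`" with `k = 0`: `U^{⊕m}` is even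
unimodular of signature `0`, `A₁` contributes `a = 1`, `δ = 1`, `σ = −1`). [cite: AlexeevNikulin2006, §9.4.1 ("`U ⊕ E₈ ⊕ A₁` … `(11, 1, 1)`")] [cite: Huybrechts2016K3, Ch. 14 §0.3 (ii)] -/
theorem invariants_hyperbolicSum_prod_A1 (m : ℕ) :
    ((LinearMap.BilinForm.hyperbolicSum m).prod
        ((2 : ℤ) • LinearMap.BilinForm.pi fun _ : Fin 1 ↦ (-1 : ℤ) • LinearMap.mul ℤ ℤ)).IsSymm ∧
    ((LinearMap.BilinForm.hyperbolicSum m).prod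
        ((2 : ℤ) • LinearMap.BilinForm.pi fun _ : Fin 1 ↦ (-1 : ℤ) • LinearMap.mul ℤ ℤ)).IsEven ∧
    ((LinearMap.BilinForm.hyperbolicSum m).prod
        ((2 : ℤ) • LinearMap.BilinForm.pi fun _ : Fin 1 ↦ (-1 : ℤ) • LinearMap.mul ℤ ℤ)).Nondegenerate ∧
    ((LinearMap.BilinForm.hyperbolicSum m).prod
        ((2 : ℤ) • LinearMap.BilinForm.pi fun _ : Fin 1 ↦ (-1 : ℤ) • LinearMap.mul ℤ ℤ)).IsTwoElementary ∧
    ((LinearMap.BilinForm.hyperbolicSum m).prod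
        ((2 : ℤ) • LinearMap.BilinForm.pi fun _ : Fin 1 ↦ (-1 : ℤ) • LinearMap.mul ℤ ℤ)).length = 1 ∧
    ((LinearMap.BilinForm.hyperbolicSum m).prod
        ((2 : ℤ) • LinearMap.BilinForm.pi fun _ : Fin 1 ↦ (-1 : ℤ) • LinearMap.mul ℤ ℤ)).signature = -1 ∧
    finrank ℤ (((Fin m → ℤ) × (Fin m → ℤ)) × (Fin 1 → ℤ)) = 2 * m + 1 ∧
    ∀ (h₁ : ((LinearMap.BilinForm.hyperbolicSum m).prod
        ((2 : ℤ) • LinearMap.BilinForm.pi fun _ : Fin 1 ↦ (-1 : ℤ) • LinearMap.mul ℤ ℤ)).Nondegenerate)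
      (h₂ : ((LinearMap.BilinForm.hyperbolicSum m).prod
        ((2 : ℤ) • LinearMap.BilinForm.pi fun _ : Fin 1 ↦ (-1 : ℤ) • LinearMap.mul ℤ ℤ)).IsSymm)
      (h₃ : ((LinearMap.BilinForm.hyperbolicSum m).prod
        ((2 : ℤ) • LinearMap.BilinForm.pi fun _ : Fin 1 ↦ (-1 : ℤ) • LinearMap.mul ℤ ℤ)).IsEven),
      ((LinearMap.BilinForm.hyperbolicSum m).prod
        ((2 : ℤ) • LinearMap.BilinForm.pi fun _ : Fin 1 ↦ (-1 : ℤ) • LinearMap.mul ℤ ℤ)).deltaInvariant h₁ h₂ h₃ = 1 := by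
  obtain ⟨hsA, heA, hA⟩ := LinearMap.BilinForm.isSymm_isEven_nondegenerate_lA1 1
  have hsU := LinearMap.BilinForm.isSymm_hyperbolicSum m
  have heU := LinearMap.BilinForm.isEven_hyperbolicSum m
  have huU := LinearMap.BilinForm.isUnimodular_hyperbolicSum m
  refine ⟨hsU.prod hsA, LinearMap.BilinForm.isEven_prod_iff.2 ⟨heU, heA⟩, huU.nondegenerate.prod hA,
    (LinearMap.BilinForm.isTwoElementary_prod_iff _ _).2
      ⟨LinearMap.BilinForm.IsTwoElementary.of_isUnimodular _ huU, LinearMap.BilinForm.isTwoElementary_lA1 1⟩,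
    (LinearMap.BilinForm.length_prod_eq_of_isUnimodular_left _ _ huU).trans (LinearMap.BilinForm.length_lA1 1),
    ?_, ?_, fun h₁ h₂ h₃ ↦ ?_⟩
  · rw [LinearMap.BilinForm.signature_prod _ _ hsU hsA, LinearMap.BilinForm.signature_hyperbolicSum,
      LinearMap.BilinForm.signature_lA1]
    simp
  · rw [Module.finrank_prod, LinearMap.BilinForm.finrank_hyperbolicSum_carrier, Module.finrank_fin_fun]
  · have hd := LinearMap.BilinForm.deltaInvariant_prod _ _ huU.nondegenerate hsU heU hA hsA heA
    rw [LinearMap.BilinForm.deltaInvariant_eq_zero_of_isUnimodular _ huU.nondegenerate hsU heU huU,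
      LinearMap.BilinForm.deltaInvariant_lA1 1 one_pos hA hsA heA, max_eq_right zero_le_one] at hd
    exact hd

/-- **`U^{⊕m} ⊕ A₁` is indefinite for `m ≥ 1`** (`|σ| = 1 < 2m + 1 = rank`). [cite: AlexeevNikulin2006, §9.4.1 ("hyperbolic lattices `S`")] [cite: Huybrechts2016K3, Ch. 14 §0.1] -/
theorem isIndefinite_hyperbolicSum_prod_A1 {m : ℕ} (hm : 0 < m) :
    ((LinearMap.BilinForm.hyperbolicSum m).prod
        ((2 : ℤ) • LinearMap.BilinForm.pi fun _ : Fin 1 ↦ (-1 : ℤ) • LinearMap.mul ℤ ℤ)).IsIndefinite := by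
  obtain ⟨hs, -, hn, -, -, hσ, hrank, -⟩ := invariants_hyperbolicSum_prod_A1 m
  rw [LinearMap.BilinForm.isIndefinite_iff_abs_signature_lt_finrank hs hn.1, hσ, hrank]
  push_cast
  rw [abs_neg, abs_one]
  omega

end Model

/-! ## §1 The invariants of `(H²(X, ℤ), s·B₂)` for a threefold of constant type: `(r, a, δ) = (15, 1, 1)`, `σ = −1` -/

section Threefold

variable {ι : Type*} [Fintype ι] [DecidableEq ι] {E : Type*} [NormedAddCommGroup E] [NormedSpace ℂ E]
  {Φ : (ι → ℝ) ≃L[ℝ] E} {n : ℕ} {η : E [⋀^Fin 2]→L[ℝ] ℝ} {d : Fin (1 + 2) → ℕ}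

/-- **The invariants of the Lefschetz lattice of degree two of a polarised abelian THREEFOLD of constant type `(d, d, d)`**
(`γ = θ_ℂ/d`, `B₂(x, y) = ⟨x, γ ∧ y⟩_e` on `H²(X, ℤ)`, `s = sign·(−1)`): **`s·B₂` is symmetric, EVEN, non-degenerate, of
rank `15 = C(6, 2)`, signature `−1 = 7 − 8` (`(b⁺, b⁻) = (2h^{2,0} + 1, h^{1,1} − 1) = (7, 8)`), with discriminant group of
order `|disc B₂| = g − 1 = 2`** — an even indefinite `2`-elementary lattice with Nikulin invariants
`(r, a, δ) = (15, 1, 1)`. [cite: Huybrechts2005, Cor. 3.3.16] [cite: Lange2023AbelianVarietiesComplex, §6.2.4 (PDF p. 310); §1.1.3 Exercise 1.1.6 (8); §2.1.1] [cite: Huybrechts2016K3, Ch. 14 §0.1 ("`A_Λ` … of order `|disc Λ|`")] [cite: AlexeevNikulin2006, §9.2] -/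
theorem IsPolarizationType.invariants_smul_of_eq_poincarePairing_wedge_threefold (hd : IsPolarizationType Φ η d)
    (hη : IsRiemannForm Φ η) (hle : 1 ≤ 1 + 2) {γ : E [⋀^Fin (2 * 1)]→L[ℝ] ℂ}
    (hγ : wedgePow (ofRealForm η) 1 = (((1 : ℕ).factorial * ∏ i : Fin 1, d (Fin.castLE hle i) : ℕ) : ℂ) • γ)
    (hd₀ : ∀ i, d i = d 0) (e : Fin n ≃ ι) (hn : 2 + (2 * 1 + 2) = n) {B : BilinForm ℤ ↥(integralForms Φ 2)}
    (hB : ∀ x y : ↥(integralForms Φ 2),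
      ((B x y : ℤ) : ℂ) = poincarePairing Φ e hn (x : E [⋀^Fin 2]→L[ℝ] ℂ) (γ.wedge (y : E [⋀^Fin 2]→L[ℝ] ℂ))) :
    ((orientationSign Φ e * (-1) ^ 1) • B).IsSymm ∧ ((orientationSign Φ e * (-1) ^ 1) • B).IsEven ∧
      ((orientationSign Φ e * (-1) ^ 1) • B).Nondegenerate ∧
      sigPos ((orientationSign Φ e * (-1) ^ 1) • B).toQuadraticMap = 7 ∧
      sigNeg ((orientationSign Φ e * (-1) ^ 1) • B).toQuadraticMap = 8 ∧
      ((orientationSign Φ e * (-1) ^ 1) • B).signature = -1 ∧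
      ∀ {κ : Type*} [Fintype κ] [DecidableEq κ] (b : Basis κ ℤ ↥(integralForms Φ 2)),
        Fintype.card κ = 15 ∧ (LinearMap.BilinForm.toMatrix b ((orientationSign Φ e * (-1) ^ 1) • B)).det.natAbs = 2 := by
  classical
  -- sign bookkeeping
  have hs1 : (orientationSign Φ e * (-1) ^ 1).natAbs = 1 := by
    rcases orientationSign_eq_or Φ e with h | h <;> rw [h] <;> simp
  have hs0 : orientationSign Φ e * (-1) ^ 1 ≠ 0 := fun h ↦ by rw [h, Int.natAbs_zero] at hs1; exact zero_ne_one hs1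
  -- the lattice `H²(X, ℤ)`
  letI : LinearOrder ι := linearOrderOfOrientation e
  let bH : Basis {w : Fin 2 → ι // StrictMono w} ℤ ↥(integralForms Φ 2) := intLatMonomialBasis Φ 2
  haveI : Module.Finite ℤ ↥(integralForms Φ 2) := Module.Finite.of_basis bH
  -- symmetry, non-degeneracy
  have hBs := isSymm_of_eq_poincarePairing_wedge e hn hB
  have hsBs : ((orientationSign Φ e * (-1) ^ 1) • B).IsSymm := LinearMap.BilinForm.isSymm_smul_of_isSymm _ _ hBs
  have hBn := hd.nondegenerate_of_eq_poincarePairing_wedge hη hle hγ e hn hB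
  have hsBn : ((orientationSign Φ e * (-1) ^ 1) • B).Nondegenerate :=
    (LinearMap.BilinForm.nondegenerate_zsmul_iff _ hs0).2 hBn
  -- `γ = θ/d` is integral, so `B₂` is even (g41-#4)
  have hγZ : γ ∈ integralForms Φ (2 * 1) := by
    obtain ⟨Φ', hΛ, hsy⟩ := hd.exists_isSymplecticEnum Φ
    obtain ⟨γ', hγ'Z, hγ'⟩ := hd.exists_mem_integralForms_wedgePow_eq_content_smul hle
    rwa [hsy.eq_of_wedgePow_eq_content_smul Φ' (hη.of_range_latticeVec_subset hΛ.le) hle hγ hγ']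
  have hBe : B.IsEven := fun x ↦ by
    obtain ⟨c, hc⟩ := exists_int_poincarePairing_wedge_self_eq_two_mul Φ two_ne_zero e hn x.2 hγZ
    refine ⟨c, ?_⟩
    apply Int.cast_injective (α := ℂ)
    rw [hB, hc, Int.cast_add]
    ring
  have hsBe : ((orientationSign Φ e * (-1) ^ 1) • B).IsEven := fun x ↦ by
    obtain ⟨c, hc⟩ := hBe x
    exact ⟨(orientationSign Φ e * (-1) ^ 1) * c, by
      rw [LinearMap.smul_apply, LinearMap.smul_apply, smul_eq_mul, hc]; ring⟩
  -- the indices `(7, 8)` (g43-#3)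
  have hsig := hd.sigPos_sigNeg_smul_of_eq_poincarePairing_wedge hη hle hγ e hn hB
  have h7 : 2 * (1 + 2).choose 2 + 1 = 7 := by decide
  have h8 : (1 + 2) * (1 + 2) - 1 = 8 := by decide
  rw [h7, h8] at hsig
  have hσ : ((orientationSign Φ e * (-1) ^ 1) • B).signature = -1 := by
    rw [LinearMap.BilinForm.signature, hsig.1, hsig.2]
    norm_num
  refine ⟨hsBs, hsBe, hsBn, hsig.1, hsig.2, hσ, fun {κ} _ _ b ↦ ⟨?_, ?_⟩⟩
  · -- rank `C(6, 2) = 15`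
    have hι : Fintype.card ι = 6 := by
      rw [← Fintype.card_congr e, Fintype.card_fin]
      omega
    have h1 := finrank_eq_card_basis bH
    rw [finrank_eq_card_basis b, Literature.AlgebraicGeometry.HodgeTheory.card_strictMono_eq_choose ι 2, hι] at h1
    exact h1
  · -- `|det| = 2` on any basis (g41-#1, constant type: `|disc B₂| = g − 1`)
    have hdet := hd.natAbs_det_poincarePairing_wedge_two_of_eq_content_smul_of_forall_eq hη hle hγ hd₀ e hn b
      (LinearMap.BilinForm.toMatrix b B) (fun i i' ↦ by rw [LinearMap.BilinForm.toMatrix_apply, hB])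
    rw [map_smul, Matrix.det_smul, Int.natAbs_mul, Int.natAbs_pow, hs1, one_pow, one_mul, hdet]

/-! ## §2 The normal form `(H²(X, ℤ), s·B₂) ≅ U^{⊕7} ⊕ A₁` and uniqueness -/

/-- **The Lefschetz lattice of degree two of a polarised abelian threefold of constant type is `U^{⊕7} ⊕ A₁`**:
`(H²(X, ℤ), s·B₂) ≅ U^{⊕7} ⊕ ⟨−2⟩` (`s = −sign`, `B₂(x, y) = ⟨x, (θ/d) ∧ y⟩_e`; for the complex orientation and a principal
polarisation this is `−(x·y·Θ)`). Proof: both sides are even indefinite `2`-elementary lattices with `(r, a, δ) = (15, 1, 1)`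
and `σ = −1` (§0, §1); by Nikulin's Thm. 3.6.2 (genus clause: the discriminant forms are isometric,
`IsTwoElementary.exists_isometry_of_invariants_eq`) and Cor. 1.13.3 / Huybrechts Thm. 1.5 (uniqueness in the genus for
`ℓ + 3 ≤ rk`, `equivalent_of_discriminantQuad_iso_of_isIndefinite_of_length_add_three_le`) they are isometric.
[cite: Nikulin1980, Thm. 3.6.2, Cor. 1.13.3] [cite: AlexeevNikulin2006, §9.2, §9.4.1] [cite: Huybrechts2016K3, Ch. 14 Thm. 1.5, Rem. 1.6] [cite: Lange2023AbelianVarietiesComplex, §6.2.4 (PDF p. 310)] -/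
theorem IsPolarizationType.smul_equivalent_hyperbolicSum_prod_A1_threefold (hd : IsPolarizationType Φ η d)
    (hη : IsRiemannForm Φ η) (hle : 1 ≤ 1 + 2) {γ : E [⋀^Fin (2 * 1)]→L[ℝ] ℂ}
    (hγ : wedgePow (ofRealForm η) 1 = (((1 : ℕ).factorial * ∏ i : Fin 1, d (Fin.castLE hle i) : ℕ) : ℂ) • γ)
    (hd₀ : ∀ i, d i = d 0) (e : Fin n ≃ ι) (hn : 2 + (2 * 1 + 2) = n) {B : BilinForm ℤ ↥(integralForms Φ 2)}
    (hB : ∀ x y : ↥(integralForms Φ 2),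
      ((B x y : ℤ) : ℂ) = poincarePairing Φ e hn (x : E [⋀^Fin 2]→L[ℝ] ℂ) (γ.wedge (y : E [⋀^Fin 2]→L[ℝ] ℂ))) :
    ((orientationSign Φ e * (-1) ^ 1) • B).Equivalent
      ((LinearMap.BilinForm.hyperbolicSum 7).prod
        ((2 : ℤ) • LinearMap.BilinForm.pi fun _ : Fin 1 ↦ (-1 : ℤ) • LinearMap.mul ℤ ℤ)) := by
  classical
  letI : LinearOrder ι := linearOrderOfOrientation e
  let bH : Basis {w : Fin 2 → ι // StrictMono w} ℤ ↥(integralForms Φ 2) := intLatMonomialBasis Φ 2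
  haveI : Module.Finite ℤ ↥(integralForms Φ 2) := Module.Finite.of_basis bH
  haveI : Module.Free ℤ ↥(integralForms Φ 2) := Module.Free.of_basis bH
  obtain ⟨hsBs, hsBe, hsBn, -, -, hσ, hbasis⟩ := hd.invariants_smul_of_eq_poincarePairing_wedge_threefold hη hle hγ hd₀ e hn hB
  obtain ⟨hcard, hdet⟩ := hbasis bH
  -- rank and discriminant group
  have hrank : finrank ℤ ↥(integralForms Φ 2) = 15 := by rw [finrank_eq_card_basis bH, hcard]
  have hdet0 : (LinearMap.BilinForm.toMatrix bH ((orientationSign Φ e * (-1) ^ 1) • B)).det ≠ 0 := fun h ↦ by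
    rw [h, Int.natAbs_zero] at hdet
    exact two_ne_zero hdet.symm
  have hA : Nat.card ((orientationSign Φ e * (-1) ^ 1) • B).discriminantGroup = 2 := by
    rw [LinearMap.BilinForm.natCard_discriminantGroup_eq _ bH hdet0, hdet]
  -- the Nikulin invariants `(a, δ) = (1, 1)`
  have h2 : ((orientationSign Φ e * (-1) ^ 1) • B).IsTwoElementary := LinearMap.BilinForm.isTwoElementary_of_natCard_eq_two _ hA
  have hℓ : ((orientationSign Φ e * (-1) ^ 1) • B).length = 1 := by
    have h := h2.natCard_eq_two_pow_length _ hsBn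
    rw [hA] at h
    exact (Nat.pow_right_injective le_rfl (show 2 ^ 1 = 2 ^ _ by rw [pow_one]; exact h)).symm
  have hδ := LinearMap.BilinForm.deltaInvariant_eq_one_of_natCard_eq_two _ hsBn hsBs hsBe hA
  -- the model
  obtain ⟨hMs, hMe, hMn, hM2, hMℓ, hMσ, hMrank, hMδ⟩ := invariants_hyperbolicSum_prod_A1 7
  have hMind := isIndefinite_hyperbolicSum_prod_A1 (m := 7) (by norm_num)
  -- Nikulin: isometric discriminant forms, then uniqueness in the genus
  obtain ⟨φ, -, hφq⟩ := h2.exists_isometry_of_invariants_eq _ _ hM2 hsBn hsBs hsBe hMn hMs hMe (hℓ.trans hMℓ.symm)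
    (hδ.trans (hMδ hMn hMs hMe).symm) (by rw [hσ, hMσ, sub_self]; exact dvd_zero 8)
  exact Literature.Topology.FourManifolds.equivalent_of_discriminantQuad_iso_of_isIndefinite_of_length_add_three_le _ _
    hsBn hsBs hsBe
    hMn hMs hMe (hrank.trans hMrank.symm) (hσ.trans hMσ.symm) φ hφq hMind (by rw [hMℓ, hMrank]; norm_num)

/-- **Orientation-free reading**: for `sign = −1` the lattice `(H²(X, ℤ), B₂)` itself is `≅ U^{⊕7} ⊕ ⟨−2⟩`; for the complex
orientation `sign = 1`, `(H²(X, ℤ), −B₂) ≅ U^{⊕7} ⊕ ⟨−2⟩`, i.e. `B₂ ≅ U^{⊕7} ⊕ ⟨2⟩` (`(b⁺, b⁻)(B₂) = (8, 7)`, g43-#3).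
[cite: Nikulin1980, Thm. 3.6.2, Cor. 1.13.3] [cite: AlexeevNikulin2006, §9.4.1] [cite: Huybrechts2016K3, Ch. 14 Thm. 1.5] -/
theorem IsPolarizationType.equivalent_hyperbolicSum_prod_A1_threefold_of_orientationSign (hd : IsPolarizationType Φ η d)
    (hη : IsRiemannForm Φ η) (hle : 1 ≤ 1 + 2) {γ : E [⋀^Fin (2 * 1)]→L[ℝ] ℂ}
    (hγ : wedgePow (ofRealForm η) 1 = (((1 : ℕ).factorial * ∏ i : Fin 1, d (Fin.castLE hle i) : ℕ) : ℂ) • γ)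
    (hd₀ : ∀ i, d i = d 0) (e : Fin n ≃ ι) (hn : 2 + (2 * 1 + 2) = n) {B : BilinForm ℤ ↥(integralForms Φ 2)}
    (hB : ∀ x y : ↥(integralForms Φ 2),
      ((B x y : ℤ) : ℂ) = poincarePairing Φ e hn (x : E [⋀^Fin 2]→L[ℝ] ℂ) (γ.wedge (y : E [⋀^Fin 2]→L[ℝ] ℂ))) :
    (orientationSign Φ e = -1 → B.Equivalent ((LinearMap.BilinForm.hyperbolicSum 7).prod
        ((2 : ℤ) • LinearMap.BilinForm.pi fun _ : Fin 1 ↦ (-1 : ℤ) • LinearMap.mul ℤ ℤ))) ∧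
    (orientationSign Φ e = 1 → (-B).Equivalent ((LinearMap.BilinForm.hyperbolicSum 7).prod
        ((2 : ℤ) • LinearMap.BilinForm.pi fun _ : Fin 1 ↦ (-1 : ℤ) • LinearMap.mul ℤ ℤ))) := by
  have h := hd.smul_equivalent_hyperbolicSum_prod_A1_threefold hη hle hγ hd₀ e hn hB
  rw [pow_one, mul_neg_one] at h
  refine ⟨fun hs ↦ ?_, fun hs ↦ ?_⟩
  · rwa [hs, neg_neg, one_smul] at h
  · rwa [hs, neg_smul, one_smul] at h

/-- **Principal polarisation**: for a principally polarised abelian threefold the lattice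
`(H²(X, ℤ), (x, y) ↦ −sign·⟨x, θ ∧ y⟩_e)` (`= −sign·(x·y·Θ)`) is isometric to `U^{⊕7} ⊕ ⟨−2⟩`.
[cite: Nikulin1980, Thm. 3.6.2, Cor. 1.13.3] [cite: AlexeevNikulin2006, §9.4.1] [cite: Lange2023AbelianVarietiesComplex, §2.1.1; §6.2.4 (PDF p. 310)] -/
theorem IsPrincipalPolarization.smul_equivalent_hyperbolicSum_prod_A1_threefold (hp : IsPrincipalPolarization Φ η)
    (e : Fin n ≃ ι) (hn : 2 + (2 * 1 + 2) = n) {B : BilinForm ℤ ↥(integralForms Φ 2)}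
    (hB : ∀ x y : ↥(integralForms Φ 2), ((B x y : ℤ) : ℂ) =
      poincarePairing Φ e hn (x : E [⋀^Fin 2]→L[ℝ] ℂ) ((wedgePow (ofRealForm η) 1).wedge (y : E [⋀^Fin 2]→L[ℝ] ℂ))) :
    ((orientationSign Φ e * (-1) ^ 1) • B).Equivalent
      ((LinearMap.BilinForm.hyperbolicSum 7).prod
        ((2 : ℤ) • LinearMap.BilinForm.pi fun _ : Fin 1 ↦ (-1 : ℤ) • LinearMap.mul ℤ ℤ)) := by
  obtain ⟨g, d', hd', h1⟩ := hp.exists_type_eq_one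
  have hg : 1 + 2 = g := by
    have h₁ := hd'.card_eq
    have h₂ := Fintype.card_congr e
    rw [Fintype.card_fin] at h₂
    omega
  have hd := hd'.comp_cast hg
  have hle : 1 ≤ 1 + 2 := by omega
  have hγ : wedgePow (ofRealForm η) 1 =
      (((1 : ℕ).factorial * ∏ i : Fin 1, d' (Fin.cast hg (Fin.castLE hle i)) : ℕ) : ℂ) • wedgePow (ofRealForm η) 1 := by
    simp only [h1, Finset.prod_const_one, mul_one, Nat.factorial_one, Nat.cast_one, one_smul]
  exact hd.smul_equivalent_hyperbolicSum_prod_A1_threefold hp.isRiemannForm hle hγ (fun i ↦ by simp only [h1])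
    e hn hB

variable (Φ) in
/-- **Existence form**: a principally polarised abelian threefold carries the lattice form `B₂(x, y) = ⟨x, θ ∧ y⟩_e` on
`H²(X, ℤ)` (an integer-valued symmetric bilinear form: cup products of integral classes are integral), and
`(H²(X, ℤ), −sign·B₂) ≅ U^{⊕7} ⊕ ⟨−2⟩`. [cite: Nikulin1980, Thm. 3.6.2, Cor. 1.13.3] [cite: Lange2023AbelianVarietiesComplex, §6.2.4 (PDF p. 310); §1.3.1 Lemma 1.3.1] -/
theorem IsPrincipalPolarization.exists_bilinForm_smul_equivalent_hyperbolicSum_prod_A1_threefold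
    (hp : IsPrincipalPolarization Φ η) (e : Fin n ≃ ι) (hn : 2 + (2 * 1 + 2) = n) :
    ∃ B : BilinForm ℤ ↥(integralForms Φ 2),
      (∀ x y : ↥(integralForms Φ 2), ((B x y : ℤ) : ℂ) =
        poincarePairing Φ e hn (x : E [⋀^Fin 2]→L[ℝ] ℂ) ((wedgePow (ofRealForm η) 1).wedge (y : E [⋀^Fin 2]→L[ℝ] ℂ))) ∧
      ((orientationSign Φ e * (-1) ^ 1) • B).Equivalent
        ((LinearMap.BilinForm.hyperbolicSum 7).prod
          ((2 : ℤ) • LinearMap.BilinForm.pi fun _ : Fin 1 ↦ (-1 : ℤ) • LinearMap.mul ℤ ℤ)) := by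
  have hθZ : wedgePow (ofRealForm η) 1 ∈ integralForms Φ (2 * 1) :=
    wedgePow_mem_integralForms Φ (ofRealForm_mem_integralForms_two Φ hp.isRiemannForm.isNSForm) 1
  obtain ⟨B, hB⟩ := exists_bilinForm_eq_poincarePairing_wedge Φ hθZ e hn
  exact ⟨B, hB, hp.smul_equivalent_hyperbolicSum_prod_A1_threefold e hn hB⟩

/-- **Uniqueness: the Lefschetz lattices of degree two of any two polarised abelian threefolds of constant type are
isometric** (after the Kähler sign): `(H²(X, ℤ), s·B₂) ≅ (H²(X', ℤ), s'·B₂')` — both are `U^{⊕7} ⊕ A₁`; in particular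
the lattice `(H²(X, ℤ), x·y·Θ)` of a principally polarised abelian threefold does not depend on `(X, Θ)`.
[cite: Nikulin1980, Thm. 3.6.2, Cor. 1.13.3] [cite: Huybrechts2016K3, Ch. 14 Thm. 1.5, Rem. 1.6] -/
theorem IsPolarizationType.smul_equivalent_smul_threefold {ι' : Type*} [Fintype ι'] [DecidableEq ι'] {E' : Type*}
    [NormedAddCommGroup E'] [NormedSpace ℂ E'] {Φ' : (ι' → ℝ) ≃L[ℝ] E'} {n' : ℕ} {η' : E' [⋀^Fin 2]→L[ℝ] ℝ}
    {d' : Fin (1 + 2) → ℕ} (hd : IsPolarizationType Φ η d) (hη : IsRiemannForm Φ η) (hd' : IsPolarizationType Φ' η' d')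
    (hη' : IsRiemannForm Φ' η') (hle : 1 ≤ 1 + 2) {γ : E [⋀^Fin (2 * 1)]→L[ℝ] ℂ} {γ' : E' [⋀^Fin (2 * 1)]→L[ℝ] ℂ}
    (hγ : wedgePow (ofRealForm η) 1 = (((1 : ℕ).factorial * ∏ i : Fin 1, d (Fin.castLE hle i) : ℕ) : ℂ) • γ)
    (hγ' : wedgePow (ofRealForm η') 1 = (((1 : ℕ).factorial * ∏ i : Fin 1, d' (Fin.castLE hle i) : ℕ) : ℂ) • γ')
    (hd₀ : ∀ i, d i = d 0) (hd₀' : ∀ i, d' i = d' 0) (e : Fin n ≃ ι) (hn : 2 + (2 * 1 + 2) = n) (e' : Fin n' ≃ ι')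
    (hn' : 2 + (2 * 1 + 2) = n') {B : BilinForm ℤ ↥(integralForms Φ 2)} {B' : BilinForm ℤ ↥(integralForms Φ' 2)}
    (hB : ∀ x y : ↥(integralForms Φ 2),
      ((B x y : ℤ) : ℂ) = poincarePairing Φ e hn (x : E [⋀^Fin 2]→L[ℝ] ℂ) (γ.wedge (y : E [⋀^Fin 2]→L[ℝ] ℂ)))
    (hB' : ∀ x y : ↥(integralForms Φ' 2),
      ((B' x y : ℤ) : ℂ) = poincarePairing Φ' e' hn' (x : E' [⋀^Fin 2]→L[ℝ] ℂ) (γ'.wedge (y : E' [⋀^Fin 2]→L[ℝ] ℂ))) :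
    ((orientationSign Φ e * (-1) ^ 1) • B).Equivalent ((orientationSign Φ' e' * (-1) ^ 1) • B') :=
  (hd.smul_equivalent_hyperbolicSum_prod_A1_threefold hη hle hγ hd₀ e hn hB).trans
    (hd'.smul_equivalent_hyperbolicSum_prod_A1_threefold hη' hle hγ' hd₀' e' hn' hB').symm

end Threefold

end Literature.Geometry.Kaehler.ComplexTorus
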